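import Mathlib
import Literature.NumberTheory.LFunctions.Zhang2022.Section16Eq162Edge
import Literature.NumberTheory.LFunctions.Zhang2022.Section7KappaLocalBounds
import Literature.NumberTheory.LFunctions.Zhang2022.ToolkitDivisorMajorants
import Literature.NumberTheory.LFunctions.Zhang2022.ToolkitEulerWeightPolylog
import HarnessLib

/-!
# Zhang (2022) §16 p. 90: the factors `κ̃₂(d₁;r,s)` and `λ₂(n,s)` of the (16.4) integrand — holomorphy on
# `σ > 9/10`, the "simple bounds", and their uniform polylogarithmic size on `σ ≥ 1 − 1/(16𝓛)`

Topic `Literature/NumberTheory/LFunctions/Zhang2022` (Landau–Siegel audit tree; verdict-neutral).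
Y. Zhang, *Discrete mean estimates and the Landau–Siegel zero*, arXiv:2211.02515v1 (2022)
[Zhang2022LandauSiegel] — **an unrefereed manuscript under adjudication** (ZHANG-L discharge lane, WP16,
chain of the leaf `Typed.Section16A.Eq16_12 c′`, node §16.u015 [Z22 p. 90, tex L4484]: "In a way similar to
the treatment of (7.19) … the expression (16.4) is equal to the residue of the integrand at `s = ρ̃` plus an
acceptable error"). The objects are those of `Zhang2022/TypedSection16A.lean`: `κ̃₂(d₁;r,s) = kappaTilde2`
(u013), `λ₂(n,s) = lam2` (u014). This theorem-only file supplies the analytic inputs on the factor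
`G(s) = κ̃₂(d₁;d₂k,s)λ₂(d₁d₂k,s)L(s+β₁,χ)` that a contour-shift engine for (16.4) consumes (the §16 twin of the
tree's §7 bounds `KappaBounds.norm_kappaTilde_le` / `norm_lam_le` and holomorphy
`Section7dStatements.differentiableOn_kappaTilde`):

* `hasSum_tau_two_rpow` — `Σ_{h∈𝔫(d)} τ₂(h)h^{−σ} = ∏_{q∣d}(1 − q^{−σ})^{−2}` (`σ > 9/10`);
* `exists_kappaTilde2_majorant`, `differentiableOn_kappaTilde2` — `κ̃₂(d₁;r,·)` is holomorphic on `σ > 9/10`;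
* `norm_kappaTilde2_le` — `|κ̃₂(d₁;r,s)| ≤ τ₂(d₁)∏_{q∣d₁}(1 − q^{−σ})^{−2}` (`σ > 9/10`; `|κ₂(n)| ≤ τ₂(n)`,
  `τ₂(d₁h) ≤ τ₂(d₁)τ₂(h)`);
* `differentiableOn_lam2`, `norm_lam2_le` — `λ₂(n,·)` holomorphic on `σ > 9/10`,
  `|λ₂(n,s)| ≤ ∏_{q∣n}(1 + 5q^{−σ})`;
* `norm_kappaTilde2_le_polylog`, `norm_lam2_le_polylog` — on `σ ≥ 1 − 1/(16L)` (`L ≥ 1`) and for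
  `log d ≤ 3L⁹`: `|κ̃₂| ≤ τ₂(d₁)·exp(10B)`, `|λ₂| ≤ exp(5B)`, `B = e(log(16L)+4)+1`, UNIFORMLY in the Euler
  weight (`EulerWeightPolylog.prod_primeFactors_one_add_mul_rpow_neg_le`; the referee route of zl-w16-ref-1).

No new definitions, no named facts, no `sorry`; nothing here asserts a claim of the manuscript.

## References

* Y. Zhang, arXiv:2211.02515v1 (2022), §16 p. 90 (u012–u015), §7 p. 40 (the "simple bounds").
  [cite: Zhang2022LandauSiegel, §16 p.90]
-/

noncomputable section

open Complex Real
open Literature.NumberTheory.LFunctions.Zhang2022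
open Literature.NumberTheory.LFunctions.Zhang2022.Skeleton
open Literature.NumberTheory.LFunctions.Zhang2022.Typed.Section16A

namespace Literature.NumberTheory.LFunctions.Zhang2022.Typed.Section16A

/-! ## The Euler product of the majorant `Σ_{h∈𝔫(d)} τ₂(h)h^{−σ}` -/

/-- `((q^e) : ℝ)^{−σ} = (q^{−σ})^e`. [folklore] -/
private theorem rpow_natPow_neg₂ (q e : ℕ) (σ : ℝ) :
    (((q ^ e : ℕ) : ℝ)) ^ (-σ) = ((q : ℝ) ^ (-σ)) ^ e := by
  rw [Nat.cast_pow, ← Real.rpow_natCast, ← Real.rpow_mul (Nat.cast_nonneg q), mul_comm,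
    Real.rpow_mul (Nat.cast_nonneg q), Real.rpow_natCast]

/-- `τ₂(q^e) = e + 1`. [folklore] -/
private theorem tau_two_prime_pow {q : ℕ} (hq : q.Prime) (e : ℕ) :
    MeanSquareMajorant.tau 2 (q ^ e) = (e : ℝ) + 1 := by
  rw [MeanSquareMajorant.tau_eq_natCoe_pow, ArithmeticFunction.natCoe_apply,
    show (2 : ℕ) = 1 + 1 from rfl, KappaBounds.zeta_pow_succ_prime_pow hq 1 e, Nat.choose_one_right]
  push_cast; ring

/-- **`Σ_{h ∈ 𝔫(d)} τ₂(h)h^{−σ} = ∏_{q∣d}(1 − q^{−σ})^{−2}`** for `σ > 9/10` (Euler product over the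
`d.primeFactors`-factored numbers; local factor `Σ_e (e+1)x^e = (1−x)^{−2}`). [cite: Zhang2022LandauSiegel, §16 p.90] -/
theorem hasSum_tau_two_rpow {σ : ℝ} (hσ : 9 / 10 < σ) (d : ℕ) :
    HasSum ((Nat.factoredNumbers d.primeFactors).indicator fun h : ℕ =>
        MeanSquareMajorant.tau 2 h * (h : ℝ) ^ (-σ))
      (∏ q ∈ d.primeFactors, 1 / (1 - (q : ℝ) ^ (-σ)) ^ 2) := by
  set F : ℕ → ℝ := fun h => MeanSquareMajorant.tau 2 h * (h : ℝ) ^ (-σ) with hF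
  have hmult := MeanSquareMajorant.isMultiplicative_tau 2
  have hF1 : F 1 = 1 := by
    simp only [hF, MeanSquareMajorant.tau_apply_one, Nat.cast_one, Real.one_rpow, mul_one]
  have hmul : ∀ {a b : ℕ}, Nat.Coprime a b → F (a * b) = F a * F b := fun {a b} hab => by
    simp only [hF]
    rw [hmult.map_mul_of_coprime hab, Nat.cast_mul, Real.mul_rpow (Nat.cast_nonneg a) (Nat.cast_nonneg b)]
    ring
  have hloc : ∀ {q : ℕ}, q.Prime → ∀ e : ℕ,
      F (q ^ e) = (((e + 1).choose 1 : ℕ) : ℝ) * ((q : ℝ) ^ (-σ)) ^ e := fun {q} hq e => by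
    simp only [hF]
    rw [tau_two_prime_pow hq, rpow_natPow_neg₂, Nat.choose_one_right]
    push_cast; ring
  have hx : ∀ {q : ℕ}, q.Prime → ‖(q : ℝ) ^ (-σ)‖ < 1 := fun {q} hq => by
    obtain ⟨h0, h1⟩ := KappaBounds.rpow_neg_range hq hσ
    rw [Real.norm_of_nonneg h0.le]; linarith
  have hsum : ∀ {q : ℕ}, q.Prime → Summable fun e : ℕ => ‖F (q ^ e)‖ := fun {q} hq => by
    have := (summable_choose_mul_geometric_of_norm_lt_one 1 (hx hq)).norm
    refine this.congr fun e => ?_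
    rw [hloc hq]
  have key := (EulerProduct.summable_and_hasSum_factoredNumbers_prod_filter_prime_tsum hF1 hmul
    hsum d.primeFactors).2
  have hfilter : d.primeFactors.filter Nat.Prime = d.primeFactors :=
    Finset.filter_true_of_mem fun q hq => Nat.prime_of_mem_primeFactors hq
  have hprod : (∏ q ∈ d.primeFactors, ∑' e : ℕ, F (q ^ e)) =
      ∏ q ∈ d.primeFactors, 1 / (1 - (q : ℝ) ^ (-σ)) ^ 2 := by
    refine Finset.prod_congr rfl fun q hq => ?_
    have hq' := Nat.prime_of_mem_primeFactors hq
    rw [tsum_congr (hloc hq'), tsum_choose_mul_geometric_of_norm_lt_one 1 (hx hq')]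
  rw [hfilter, hprod] at key
  exact hasSum_subtype_iff_indicator.mp key

/-! ## `κ̃₂(d₁;r,·)`: majorant, holomorphy, bound -/

section KappaTilde

variable (c' : ℝ) {D : ℕ} (χ : DirichletCharacter ℂ D)

/-- Membership in `𝔫(d₁)` is membership in the `d₁.primeFactors`-factored numbers (`d₁ ≠ 0`).
[cite: Zhang2022LandauSiegel, §7 p.32] -/
private theorem mem_factoredNumbers_of_mem_nset {d₁ h : ℕ} (hd₁ : d₁ ≠ 0) (hh : h ∈ nset d₁) :
    h ∈ Nat.factoredNumbers d₁.primeFactors :=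
  Nat.mem_factoredNumbers_iff_primeFactors_subset.mpr ⟨hh.1.ne', fun q hq => by
    have hq' := Nat.mem_primeFactors.mp hq
    exact Nat.mem_primeFactors.mpr ⟨hq'.1, hh.2 q hq'.1 hq'.2.1, hd₁⟩⟩

open scoped Classical in
/-- **A uniform majorant for the terms of `κ̃₂(d₁;r,s)` on `σ ≥ σ₀ > 9/10`**: with
`u(h) = τ₂(d₁)·𝟙[h ∈ 𝔫(d₁)]τ₂(h)h^{−σ₀}` (summable by `hasSum_tau_two_rpow`),
`‖𝟙[h∈𝔫(d₁),(h,r)=1] κ₂(d₁h)χ(h)/h^s‖ ≤ u(h)` (`|κ₂(n)| ≤ τ₂(n)`, `τ₂(d₁h) ≤ τ₂(d₁)τ₂(h)`, `|χ| ≤ 1`).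
[cite: Zhang2022LandauSiegel, §16 p.90 (u013)] -/
theorem exists_kappaTilde2_majorant {d₁ : ℕ} (hd₁ : d₁ ≠ 0) (r : ℕ) {σ₀ : ℝ} (hσ₀ : 9 / 10 < σ₀) :
    ∃ u : ℕ → ℝ, Summable u ∧ (∀ h, 0 ≤ u h) ∧
      (∑' h, u h) = MeanSquareMajorant.tau 2 d₁ * ∏ q ∈ d₁.primeFactors, 1 / (1 - (q : ℝ) ^ (-σ₀)) ^ 2 ∧
      ∀ (h : ℕ) (s : ℂ), σ₀ ≤ s.re →
        ‖(if h ∈ nset d₁ ∧ Nat.Coprime h r then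
            kappa2 c' D (d₁ * h) * χ (h : ZMod D) / (h : ℂ) ^ s else 0)‖ ≤ u h := by
  set G : ℕ → ℝ := fun h => MeanSquareMajorant.tau 2 h * (h : ℝ) ^ (-σ₀) with hG
  have hsumG := hasSum_tau_two_rpow hσ₀ d₁
  set u : ℕ → ℝ := fun h =>
    MeanSquareMajorant.tau 2 d₁ * (Nat.factoredNumbers d₁.primeFactors).indicator G h with hu
  have hG0 : ∀ h, 0 ≤ G h := fun h => by
    have := MeanSquareMajorant.tau_nonneg 2 h; positivity
  have hτd0 : 0 ≤ MeanSquareMajorant.tau 2 d₁ := MeanSquareMajorant.tau_nonneg _ _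
  have hu0 : ∀ h, 0 ≤ u h := fun h =>
    mul_nonneg hτd0 (Set.indicator_nonneg (fun _ _ => hG0 _) _)
  refine ⟨u, (hsumG.mul_left _).summable, hu0, ?_, fun h s hs => ?_⟩
  · exact (hsumG.mul_left _).tsum_eq
  by_cases hh : h ∈ nset d₁ ∧ Nat.Coprime h r
  · have h0 : h ≠ 0 := hh.1.1.ne'
    have hmem : h ∈ Nat.factoredNumbers d₁.primeFactors := mem_factoredNumbers_of_mem_nset hd₁ hh.1
    rw [if_pos hh]
    simp only [hu, Set.indicator_of_mem hmem, hG]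
    rw [norm_div, norm_mul, Complex.norm_natCast_cpow_of_pos (Nat.pos_of_ne_zero h0)]
    have hh1 : (1 : ℝ) ≤ h := by exact_mod_cast Nat.pos_of_ne_zero h0
    have hhpos : (0 : ℝ) < (h : ℝ) ^ s.re := Real.rpow_pos_of_pos (by linarith) _
    have hexp : ((h : ℝ) ^ s.re)⁻¹ ≤ (h : ℝ) ^ (-σ₀) := by
      rw [← Real.rpow_neg (Nat.cast_nonneg h)]
      exact Real.rpow_le_rpow_of_exponent_le hh1 (by linarith)
    have hκ : ‖kappa2 c' D (d₁ * h)‖ ≤ MeanSquareMajorant.tau 2 d₁ * MeanSquareMajorant.tau 2 h := by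
      have h1 := Skeleton.norm_kappa2AF_le (b1 c' D) (d₁ * h)
      rw [one_mul] at h1
      exact h1.trans (MeanSquareMajorant.tau_mul_le 2 d₁ h)
    have hχ : ‖χ (h : ZMod D)‖ ≤ 1 := DirichletCharacter.norm_le_one χ _
    rw [div_eq_mul_inv]
    have hτ0 : 0 ≤ MeanSquareMajorant.tau 2 d₁ * MeanSquareMajorant.tau 2 h :=
      mul_nonneg hτd0 (MeanSquareMajorant.tau_nonneg _ _)
    calc ‖kappa2 c' D (d₁ * h)‖ * ‖χ (h : ZMod D)‖ * ((h : ℝ) ^ s.re)⁻¹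
        ≤ (MeanSquareMajorant.tau 2 d₁ * MeanSquareMajorant.tau 2 h) * 1 * (h : ℝ) ^ (-σ₀) :=
          mul_le_mul (mul_le_mul hκ hχ (norm_nonneg _) hτ0) hexp (inv_nonneg.mpr hhpos.le)
            (mul_nonneg hτ0 zero_le_one)
      _ = MeanSquareMajorant.tau 2 d₁ * (MeanSquareMajorant.tau 2 h * (h : ℝ) ^ (-σ₀)) := by ring
  · rw [if_neg hh, norm_zero]
    exact hu0 h

open scoped Classical in
/-- **`κ̃₂(d₁;r,·)` is holomorphic on `σ > 9/10`** (`d₁ ≥ 1`): on every half-plane `σ > σ₀ > 9/10` it is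
the locally uniform limit of its partial sums (`differentiableOn_tsum_of_summable_norm`), and holomorphy is
local. [cite: Zhang2022LandauSiegel, §16 p.90 (u013)] -/
theorem differentiableOn_kappaTilde2 {d₁ : ℕ} (hd₁ : d₁ ≠ 0) (r : ℕ) :
    DifferentiableOn ℂ (fun s => kappaTilde2 c' χ d₁ r s) {s : ℂ | 9 / 10 < s.re} := by
  -- holomorphy on each half-plane `σ > σ₀`, `σ₀ > 9/10`
  have hplane : ∀ σ₀ : ℝ, 9 / 10 < σ₀ →
      DifferentiableOn ℂ (fun s => kappaTilde2 c' χ d₁ r s) {s : ℂ | σ₀ < s.re} := by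
    intro σ₀ hσ₀
    obtain ⟨u, hu, -, -, hle⟩ := exists_kappaTilde2_majorant c' χ hd₁ r hσ₀
    have hopen : IsOpen {s : ℂ | σ₀ < s.re} := isOpen_lt continuous_const Complex.continuous_re
    have h := differentiableOn_tsum_of_summable_norm (U := {s : ℂ | σ₀ < s.re})
      (F := fun (h : ℕ) (s : ℂ) => if h ∈ nset d₁ ∧ Nat.Coprime h r then
        kappa2 c' D (d₁ * h) * χ (h : ZMod D) / (h : ℂ) ^ s else 0) hu ?_ hopen ?_
    · refine h.congr fun s _ => ?_
      simp only [kappaTilde2]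
    · intro h
      by_cases hh : h ∈ nset d₁ ∧ Nat.Coprime h r
      · simp only [if_pos hh]
        intro s _
        have h0 : (h : ℂ) ≠ 0 := Nat.cast_ne_zero.mpr hh.1.1.ne'
        have hne : (h : ℂ) ^ s ≠ 0 := fun hz => h0 ((cpow_eq_zero_iff _ _).mp hz).1
        exact ((differentiableAt_const _).div (differentiableAt_id.const_cpow (Or.inl h0))
          hne).differentiableWithinAt
      · simp only [if_neg hh]
        exact differentiableOn_const _
    · intro h s hs
      exact hle h s (le_of_lt hs)
  intro s hs
  have hσ₀ : 9 / 10 < (9 / 10 + s.re) / 2 := by simp only [Set.mem_setOf_eq] at hs; linarith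
  have hmem : s ∈ {z : ℂ | (9 / 10 + s.re) / 2 < z.re} := by
    simp only [Set.mem_setOf_eq] at hs ⊢; linarith
  have hopen : IsOpen {z : ℂ | (9 / 10 + s.re) / 2 < z.re} := isOpen_lt continuous_const Complex.continuous_re
  exact ((hplane _ hσ₀).differentiableAt (hopen.mem_nhds hmem)).differentiableWithinAt

open scoped Classical in
/-- **The "simple bound" for `κ̃₂`**: `|κ̃₂(d₁;r,s)| ≤ τ₂(d₁)∏_{q∣d₁}(1 − q^{−σ})^{−2}` for `σ > 9/10`
(`d₁ ≥ 1`). [cite: Zhang2022LandauSiegel, §16 p.90; §7 p.40] -/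
theorem norm_kappaTilde2_le {d₁ : ℕ} (hd₁ : d₁ ≠ 0) (r : ℕ) {s : ℂ} (hs : 9 / 10 < s.re) :
    ‖kappaTilde2 c' χ d₁ r s‖ ≤
      MeanSquareMajorant.tau 2 d₁ * ∏ q ∈ d₁.primeFactors, 1 / (1 - (q : ℝ) ^ (-s.re)) ^ 2 := by
  obtain ⟨u, hu, hu0, hsum, hle⟩ := exists_kappaTilde2_majorant c' χ hd₁ r hs
  have hsumm : Summable fun h : ℕ => ‖(if h ∈ nset d₁ ∧ Nat.Coprime h r then
      kappa2 c' D (d₁ * h) * χ (h : ZMod D) / (h : ℂ) ^ s else 0)‖ :=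
    Summable.of_nonneg_of_le (fun _ => norm_nonneg _) (fun h => hle h s le_rfl) hu
  rw [kappaTilde2, ← hsum]
  exact (norm_tsum_le_tsum_norm hsumm).trans (Summable.tsum_le_tsum (fun h => hle h s le_rfl) hsumm hu)

end KappaTilde

/-! ## `λ₂(n,·)`: holomorphy and bound -/

section Lam

variable (c' : ℝ) {D : ℕ} (χ : DirichletCharacter ℂ D)

/-- `|χ(q)q^{−s−β}| = ... ≤ q^{−σ}` for a purely imaginary `β`, `q ≥ 1`. [cite: Zhang2022LandauSiegel, §2 (2.13)] -/
private theorem norm_chi_mul_cpow_le {q : ℕ} (hq : 0 < q) (s β : ℂ) (hβ : β.re = 0) :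
    ‖χ (q : ZMod D) * (q : ℂ) ^ (-(s + β))‖ ≤ (q : ℝ) ^ (-s.re) := by
  rw [norm_mul, Complex.norm_natCast_cpow_of_pos hq]
  have h1 : ‖χ (q : ZMod D)‖ ≤ 1 := DirichletCharacter.norm_le_one χ _
  have h2 : (-(s + β)).re = -s.re := by simp [hβ]
  rw [h2]
  calc ‖χ (q : ZMod D)‖ * (q : ℝ) ^ (-s.re) ≤ 1 * (q : ℝ) ^ (-s.re) :=
        mul_le_mul_of_nonneg_right h1 (Real.rpow_nonneg (Nat.cast_nonneg q) _)
    _ = _ := one_mul _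

/-- For a prime `q` and `σ > 0`: `1 − χ(q)q^{−s} ≠ 0` (`|χ(q)q^{−s}| ≤ q^{−σ} < 1`).
[cite: Zhang2022LandauSiegel, §16 p.90 (u014)] -/
theorem one_sub_chi_cpow_ne_zero {q : ℕ} (hq : q.Prime) {s : ℂ} (hs : 0 < s.re) :
    1 - χ (q : ZMod D) * (q : ℂ) ^ (-s) ≠ 0 := by
  have hq2 : (2 : ℝ) ≤ q := by exact_mod_cast hq.two_le
  have hlt : ‖χ (q : ZMod D) * (q : ℂ) ^ (-s)‖ < 1 := by
    have h := norm_chi_mul_cpow_le χ hq.pos s 0 (by simp)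
    rw [add_zero] at h
    refine lt_of_le_of_lt h ?_
    calc (q : ℝ) ^ (-s.re) < (q : ℝ) ^ (0 : ℝ) :=
          Real.rpow_lt_rpow_of_exponent_lt (by linarith) (by linarith)
      _ = 1 := Real.rpow_zero _
  intro h0
  have : χ (q : ZMod D) * (q : ℂ) ^ (-s) = 1 := by linear_combination -h0
  rw [this, norm_one] at hlt
  exact lt_irrefl _ hlt

/-- **`λ₂(n,·)` is holomorphic on `σ > 0`** (a finite product of quotients whose denominators
`1 − χ(q)q^{−s}` do not vanish there). [cite: Zhang2022LandauSiegel, §16 p.90 (u014)] -/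
theorem differentiableOn_lam2 (n : ℕ) :
    DifferentiableOn ℂ (fun s => lam2 c' χ n s) {s : ℂ | 0 < s.re} := by
  have h : (fun s => lam2 c' χ n s) = fun s => ∏ q ∈ n.primeFactors,
      (1 - χ (q : ZMod D) * (q : ℂ) ^ (-(s + beta1 c' D))) / (1 - χ (q : ZMod D) * (q : ℂ) ^ (-s)) := by
    funext s; rfl
  rw [h]
  refine DifferentiableOn.fun_finsetProd (u := n.primeFactors)
    (f := fun q s => (1 - χ (q : ZMod D) * (q : ℂ) ^ (-(s + beta1 c' D))) /
      (1 - χ (q : ZMod D) * (q : ℂ) ^ (-s))) fun q hq => ?_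
  have hq := Nat.prime_of_mem_primeFactors hq
  have hq0 : (q : ℂ) ≠ 0 := Nat.cast_ne_zero.mpr hq.ne_zero
  intro s hs
  refine DifferentiableAt.differentiableWithinAt ?_
  refine DifferentiableAt.div ?_ ?_ (one_sub_chi_cpow_ne_zero χ hq hs)
  · exact (differentiableAt_const _).sub ((differentiableAt_const _).mul
      ((differentiableAt_id.add_const _).neg.const_cpow (Or.inl hq0)))
  · exact (differentiableAt_const _).sub ((differentiableAt_const _).mul
      (differentiableAt_id.neg.const_cpow (Or.inl hq0)))

/-- **The "simple bound" for `λ₂`**: `|λ₂(n,s)| ≤ ∏_{q∣n}(1 + 5q^{−σ})` for `σ > 9/10` (each factor has norm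
`≤ (1 + x)/(1 − x) ≤ 1 + 5x`, `x = q^{−σ} ≤ 3/5`). [cite: Zhang2022LandauSiegel, §16 p.90; §7 p.40] -/
theorem norm_lam2_le (n : ℕ) {s : ℂ} (hs : 9 / 10 < s.re) :
    ‖lam2 c' χ n s‖ ≤ ∏ q ∈ n.primeFactors, (1 + 5 * (q : ℝ) ^ (-s.re)) := by
  have hβ : (beta1 c' D).re = 0 := by simp [beta1]
  rw [lam2, Complex.norm_prod]
  refine Finset.prod_le_prod (fun q _ => norm_nonneg _) fun q hq => ?_
  have hq := Nat.prime_of_mem_primeFactors hq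
  obtain ⟨hx0, hx35⟩ := KappaBounds.rpow_neg_range hq hs
  set x : ℝ := (q : ℝ) ^ (-s.re) with hx
  have hnum : ‖1 - χ (q : ZMod D) * (q : ℂ) ^ (-(s + beta1 c' D))‖ ≤ 1 + x := by
    calc ‖1 - χ (q : ZMod D) * (q : ℂ) ^ (-(s + beta1 c' D))‖
        ≤ ‖(1 : ℂ)‖ + ‖χ (q : ZMod D) * (q : ℂ) ^ (-(s + beta1 c' D))‖ := norm_sub_le _ _
      _ ≤ 1 + x := by rw [norm_one]; exact add_le_add_right (norm_chi_mul_cpow_le χ hq.pos s _ hβ) _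
  have hden : 1 - x ≤ ‖1 - χ (q : ZMod D) * (q : ℂ) ^ (-s)‖ := by
    have h := norm_chi_mul_cpow_le χ hq.pos s 0 (by simp)
    rw [add_zero] at h
    calc 1 - x ≤ ‖(1 : ℂ)‖ - ‖χ (q : ZMod D) * (q : ℂ) ^ (-s)‖ := by rw [norm_one]; linarith
      _ ≤ ‖1 - χ (q : ZMod D) * (q : ℂ) ^ (-s)‖ := norm_sub_norm_le _ _
  have h1x : 0 < 1 - x := by linarith
  rw [norm_div]
  calc ‖1 - χ (q : ZMod D) * (q : ℂ) ^ (-(s + beta1 c' D))‖ / ‖1 - χ (q : ZMod D) * (q : ℂ) ^ (-s)‖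
      ≤ (1 + x) / (1 - x) := div_le_div₀ (by linarith) hnum h1x hden
    _ ≤ 1 + 5 * x := by
        rw [div_le_iff₀ h1x]; nlinarith

end Lam

/-! ## Uniform polylogarithmic sizes on `σ ≥ 1 − 1/(16L)` -/

section Polylog

variable (c' : ℝ) {D : ℕ} (χ : DirichletCharacter ℂ D)

/-- `(1 − x)^{−2} ≤ 1 + 10x` for `0 ≤ x ≤ 3/5`. [folklore] -/
private theorem one_div_one_sub_sq_le {x : ℝ} (h0 : 0 ≤ x) (h1 : x ≤ 3 / 5) :
    1 / (1 - x) ^ 2 ≤ 1 + 10 * x := by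
  have hpos : 0 < (1 - x) ^ 2 := by nlinarith
  rw [div_le_iff₀ hpos]
  nlinarith [mul_nonneg h0 h0, mul_nonneg (mul_nonneg h0 h0) h0]

/-- **`|κ̃₂(d₁;r,s)| ≤ τ₂(d₁)·exp(10(e(log(16L)+4)+1))`** uniformly for `L ≥ 1`, `σ ≥ 1 − 1/(16L)`, `d₁ ≥ 1`
with `log d₁ ≤ 3L⁹` — the Euler weight is polylogarithmic in `e^L` on Landau's line.
[cite: Zhang2022LandauSiegel, §16 p.90] -/
theorem norm_kappaTilde2_le_polylog {L : ℝ} (hL : 1 ≤ L) {d₁ : ℕ} (hd₁ : d₁ ≠ 0) (r : ℕ)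
    (hlog : Real.log d₁ ≤ 3 * L ^ 9) {s : ℂ} (hs : 1 - 1 / (16 * L) ≤ s.re) :
    ‖kappaTilde2 c' χ d₁ r s‖ ≤
      MeanSquareMajorant.tau 2 d₁ * Real.exp (10 * (Real.exp 1 * (Real.log (16 * L) + 4) + 1)) := by
  have h16 : 1 / (16 * L) ≤ 1 / 16 := by
    rw [div_le_div_iff₀ (by positivity) (by norm_num)]; linarith
  have hs9 : 9 / 10 < s.re := by linarith
  refine (norm_kappaTilde2_le c' χ hd₁ r hs9).trans ?_
  refine mul_le_mul_of_nonneg_left ?_ (MeanSquareMajorant.tau_nonneg _ _)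
  have h1 : ∏ q ∈ d₁.primeFactors, 1 / (1 - (q : ℝ) ^ (-s.re)) ^ 2 ≤
      ∏ q ∈ d₁.primeFactors, (1 + 10 * (q : ℝ) ^ (-s.re)) := by
    refine Finset.prod_le_prod (fun q hq => by positivity) fun q hq => ?_
    obtain ⟨hx0, hx35⟩ := KappaBounds.rpow_neg_range (Nat.prime_of_mem_primeFactors hq) hs9
    exact one_div_one_sub_sq_le hx0.le hx35
  exact h1.trans (EulerWeightPolylog.prod_primeFactors_one_add_mul_rpow_neg_le hL hs (by norm_num) hd₁ hlog)

/-- **`|λ₂(n,s)| ≤ exp(5(e(log(16L)+4)+1))`** uniformly for `L ≥ 1`, `σ ≥ 1 − 1/(16L)`, `n ≥ 1` with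
`log n ≤ 3L⁹`. [cite: Zhang2022LandauSiegel, §16 p.90] -/
theorem norm_lam2_le_polylog {L : ℝ} (hL : 1 ≤ L) {n : ℕ} (hn : n ≠ 0) (hlog : Real.log n ≤ 3 * L ^ 9)
    {s : ℂ} (hs : 1 - 1 / (16 * L) ≤ s.re) :
    ‖lam2 c' χ n s‖ ≤ Real.exp (5 * (Real.exp 1 * (Real.log (16 * L) + 4) + 1)) := by
  have h16 : 1 / (16 * L) ≤ 1 / 16 := by
    rw [div_le_div_iff₀ (by positivity) (by norm_num)]; linarith
  have hs9 : 9 / 10 < s.re := by linarith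
  exact (norm_lam2_le c' χ n hs9).trans
    (EulerWeightPolylog.prod_primeFactors_one_add_mul_rpow_neg_le hL hs (by norm_num) hn hlog)

end Polylog

end Literature.NumberTheory.LFunctions.Zhang2022.Typed.Section16A
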